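import Literature.Topology.FourManifolds.WhitneyDiscCollarGeometry
import Literature.Topology.FourManifolds.WhitneyDiscCollarFormula
import HarnessLib

/-!
# The collar of the Whitney disc in the manifold, II: the core germ along `C ∪ C'`
# (Milnor 1965, proof of Lemma 6.7, PDF pp. 41–43)

Topic `Literature/Topology/FourManifolds`; continuation of `WhitneyDiscCollarGeometry.lean`.
From the data of Milnor's Theorem 6.6 — two embedded submanifolds `M = e(P)`, `M' = e'(Q)` of
`V` meeting transversally at `p`, `q`, product neighbourhoods `Λ₁ : ℝ × F₁ → P`,
`Λ₂ : ℝ × F₂ → Q` of the two arcs `C`, `C'` from `p` to `q` avoiding the other double points —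
placed in `ℝᴺ` by a Whitney embedding `ι` with normal retraction `r` (the tree's metric-free
replacement of Milnor's Riemannian metric, `NormalRetraction.lean`), this file produces the
**germ of the Whitney disc along its boundary**: a smooth `φ̂ : ℝ × ℝ → ℝᴺ` (the plane-model
collar formula of `WhitneyDiscCollarFormula.lean`, fed with the forbidden frames of
`WhitneyDiscCollarGeometry.lean` and the transversal fields of `TransversalFieldAlongArc.lean`)
such that `Φ = r ∘ φ̂` carries the parabola `y = x² - 1` onto `C` and the axis `y = 0` onto `C'`,
and on an open neighbourhood `𝒰` of the two boundary arcs of `D̄` is a smooth injective immersion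
meeting `M` only along the parabola and `M'` only along the axis, with the frame condition of
Lemma 6.7 along both arcs (the disc direction, the arc direction and the fibre directions of the
product neighbourhood are independent).  Printed (PDF p. 41): *"the imbedded disc `U'` … with
boundary `C ∪ C'` … `U' ∩ (M ∪ M') = C ∪ C'`"*, (PDF p. 43) *"which intersects `M` and `M'`
precisely in `C` and `C'`, transversely"*.

* `Literature.Topology.FourManifolds.injective_comp_of_apply_mem_orthogonal_imp` — the linear
  algebra of `dr = dι⁻¹ ∘ P_T`;
* `Literature.Topology.FourManifolds.half_sub_notMem_sup_orthogonal` — the corner values of the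
  transversal fields avoid the forbidden ranges (transversality of `M`, `M'` at `p`, `q`);
* `Literature.Topology.FourManifolds.eventually_mem_range_imp_eq_graph` — near a sheet through
  an arc, points of `M` lie on the sheet (local form of *"intersects `M` precisely in `C`"*);
* `Literature.Topology.FourManifolds.exists_whitneyCollarCore` — the core germ.

Everything is proved; no definitions, no named facts.

## References

* J. Milnor, *Lectures on the h-cobordism theorem*, notes by L. Siebenmann and J. Sondow,
  Princeton Mathematical Notes (1965), proof of Lemma 6.7, PDF pp. 41–43.  Held:
  `lit read book:milnornd-lectures-h-cobordism-theorem --pages 41-45`. [MilnorHCobordism1965]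
-/

open Set Function Filter Module Metric Topology
open scoped Manifold ContDiff Topology RealInnerProductSpace

noncomputable section

namespace Literature.Topology.FourManifolds

/-! ### Linear algebra of the retraction -/

/-- **`L ∘ B` is injective when `B` has no kernel modulo the normal space.**  `Dι : E → W`
injective with range `T`, `L : W → E` a left inverse of `Dι` killing `Tᗮ`, `B : X → W` linear
with `B w ∈ Tᗮ ⇒ w = 0`; then `L ∘ B` is injective. [folklore] -/
theorem injective_comp_of_apply_mem_orthogonal_imp {E W X : Type*} [NormedAddCommGroup E]
    [NormedSpace ℝ E] [NormedAddCommGroup W] [InnerProductSpace ℝ W] [FiniteDimensional ℝ W]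
    [NormedAddCommGroup X] [NormedSpace ℝ X] {Dι : E →L[ℝ] W} {L : W →L[ℝ] E}
    (hLι : ∀ a, L (Dι a) = a)
    (hLN : ∀ w ∈ (LinearMap.range (Dι : E →ₗ[ℝ] W))ᗮ, L w = 0) {B : X →L[ℝ] W}
    (hB : ∀ w, B w ∈ (LinearMap.range (Dι : E →ₗ[ℝ] W))ᗮ → w = 0) : Injective (L.comp B) := by
  refine (injective_iff_map_eq_zero _).2 fun w hw => ?_
  set T : Submodule ℝ W := LinearMap.range (Dι : E →ₗ[ℝ] W)
  have hy : L (B w) = 0 := hw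
  set y := B w with hy_def
  obtain ⟨a, ha⟩ : T.starProjection y ∈ T := Submodule.starProjection_apply_mem T y
  have ha' : Dι a = T.starProjection y := ha
  have ha0 : a = 0 := by
    have h1 : L y = L (T.starProjection y) + L (y - T.starProjection y) := by
      rw [← map_add, add_sub_cancel]
    rw [hy, hLN _ (Submodule.sub_starProjection_mem_orthogonal y), add_zero, ← ha', hLι] at h1
    exact h1.symm
  have hPy : T.starProjection y = 0 := by rw [← ha', ha0, map_zero]
  have hyN : y ∈ Tᗮ := by
    have := Submodule.sub_starProjection_mem_orthogonal (K := T) y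
    rwa [hPy, sub_zero] at this
  exact hB w hyN

/-- `Dι (L t) = t` for tangent `t`. [folklore] -/
theorem apply_leftInverse_of_mem_range {E W : Type*} [NormedAddCommGroup E] [NormedSpace ℝ E]
    [NormedAddCommGroup W] [NormedSpace ℝ W] {Dι : E →L[ℝ] W} {L : W →L[ℝ] E}
    (hLι : ∀ a, L (Dι a) = a) {t : W} (ht : t ∈ LinearMap.range (Dι : E →ₗ[ℝ] W)) :
    Dι (L t) = t := by
  obtain ⟨a, rfl⟩ := ht
  change Dι (L (Dι a)) = Dι a
  rw [hLι]

/-! ### The corner values of the transversal fields -/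

/-- **Transversality at a corner.**  In an inner product space let `R, R' ≤ T` be subspaces
with `R ⊓ R' = ⊥` (the tangent spaces of `M`, `M'` at `p`, inside `T = T_p V`), `N = Tᗮ`, and
`c ∈ R`, `c' ∈ R'` with `c' ≠ 0` (the tangents of the two arcs).  Then `(c' - c)/2 ∉ R ⊔ N`.
[folklore] -/
theorem half_sub_notMem_sup_orthogonal {W : Type*} [NormedAddCommGroup W] [InnerProductSpace ℝ W]
    {T R R' : Submodule ℝ W} (hRT : R ≤ T) (hR'T : R' ≤ T) (hRR' : R ⊓ R' = ⊥) {c c' : W}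
    (hc : c ∈ R) (hc' : c' ∈ R') (hc'0 : c' ≠ 0) : (1 / 2 : ℝ) • (c' - c) ∉ R ⊔ Tᗮ := by
  intro h
  obtain ⟨t, ht, nn, hnn, hsum⟩ := Submodule.mem_sup.1 h
  -- `2 nn = c' - c - 2 t ∈ T ∩ Tᗮ = 0`
  have hnnT : (2 : ℝ) • nn ∈ T := by
    have : (2 : ℝ) • nn = c' - c - (2 : ℝ) • t := by
      have h2 : (2 : ℝ) • (t + nn) = c' - c := by
        rw [hsum, smul_smul]; norm_num
      rw [smul_add] at h2
      exact eq_sub_of_add_eq' h2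
    rw [this]
    exact T.sub_mem (T.sub_mem (hR'T hc') (hRT hc)) (T.smul_mem _ (hRT ht))
  have hnn0 : nn = 0 := by
    have hmem : (2 : ℝ) • nn ∈ T ⊓ Tᗮ := ⟨hnnT, Submodule.smul_mem _ _ hnn⟩
    rw [Submodule.inf_orthogonal_eq_bot, Submodule.mem_bot] at hmem
    exact (smul_eq_zero.1 hmem).resolve_left (by norm_num)
  -- hence `c' = c + 2 t ∈ R ∩ R' = 0`
  have hc'R : c' ∈ R := by
    have : c' = c + (2 : ℝ) • t := by
      have h2 : (2 : ℝ) • (t + nn) = c' - c := by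
        rw [hsum, smul_smul]; norm_num
      rw [hnn0, add_zero] at h2
      rw [h2]; abel
    rw [this]
    exact R.add_mem hc (R.smul_mem _ ht)
  have : c' ∈ R ⊓ R' := ⟨hc'R, hc'⟩
  rw [hRR', Submodule.mem_bot] at this
  exact hc'0 this

/-! ### Points of `M` near a sheet lie on the sheet -/

/-- **Near a sheet through an arc of `M`, the points of `M` lie on the sheet.**  Let
`e : P → V` be an embedding (inducing), `Λ : ℝ × F → P` a local homeomorphism, `γ : ℝ → ℝ`
continuous, and `Z : (ℝ × ℝ) × F → V` injective on an open `𝒱` with the sheet identity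
`Z((x, γ x), w) = e(Λ(x, w))` and core `Z(u, 0) = Φ u`, `Φ` continuous at `(x₀, γ x₀)`,
`((x₀, γ x₀), 0) ∈ 𝒱`.  Then for `u` near `(x₀, γ x₀)`, `Φ u ∈ e(P)` forces `u.2 = γ u.1`.
(Milnor 1965, PDF p. 43: the disc *"intersects `M` … precisely in `C`"*; p. 45: *"Image(φ)
intersects `M` … precisely in the above product neighborhood of `C`"*.) [folklore] -/
theorem eventually_mem_range_imp_eq_graph {P Y F : Type*} [TopologicalSpace P]
    [TopologicalSpace Y] [TopologicalSpace F] [Zero F] {e : P → Y} (he : IsInducing e)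
    {Λ : ℝ × F → P} (hΛ : IsLocalHomeomorph Λ) {γ : ℝ → ℝ} (hγ : Continuous γ)
    {Φ : ℝ × ℝ → Y} {Z : (ℝ × ℝ) × F → Y} {𝒱 : Set ((ℝ × ℝ) × F)} (h𝒱 : IsOpen 𝒱)
    (hinj : InjOn Z 𝒱) (hsheet : ∀ x w, Z ((x, γ x), w) = e (Λ (x, w)))
    (hcore : ∀ u, Z (u, 0) = Φ u) {x₀ : ℝ} (hx₀ : (((x₀, γ x₀), 0) : (ℝ × ℝ) × F) ∈ 𝒱)
    (hΦc : ContinuousAt Φ (x₀, γ x₀)) :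
    ∀ᶠ u in 𝓝 (x₀, γ x₀), Φ u ∈ range e → u.2 = γ u.1 := by
  -- a chart of `Λ` at `(x₀, 0)` and the part of its source over `𝒱`
  obtain ⟨ℓ, hℓx, hℓ⟩ := hΛ (x₀, 0)
  set 𝒪 : Set (ℝ × F) := ℓ.source ∩ {z | (((z.1, γ z.1), z.2) : (ℝ × ℝ) × F) ∈ 𝒱} with h𝒪
  have h𝒪o : IsOpen 𝒪 :=
    ℓ.open_source.inter (h𝒱.preimage (by fun_prop))
  have hx𝒪 : ((x₀, 0) : ℝ × F) ∈ 𝒪 := ⟨hℓx, hx₀⟩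
  -- its image is open in `P`, hence the trace of an open set of `Y`
  have himo : IsOpen (ℓ '' 𝒪) := ℓ.isOpen_image_of_subset_source h𝒪o inter_subset_left
  obtain ⟨𝒯, h𝒯o, h𝒯⟩ := (he.isOpen_iff).1 himo
  have hΦ0 : Φ (x₀, γ x₀) = e (Λ (x₀, 0)) := by rw [← hcore, hsheet]
  have hmem𝒯 : Φ (x₀, γ x₀) ∈ 𝒯 := by
    have : Λ (x₀, 0) ∈ e ⁻¹' 𝒯 := by
      rw [h𝒯, hℓ]
      exact ⟨_, hx𝒪, rfl⟩
    rwa [hΦ0]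
  have hev1 : ∀ᶠ u in 𝓝 (x₀, γ x₀), Φ u ∈ 𝒯 := hΦc.preimage_mem_nhds (h𝒯o.mem_nhds hmem𝒯)
  have hev2 : ∀ᶠ u : ℝ × ℝ in 𝓝 (x₀, γ x₀), ((u, 0) : (ℝ × ℝ) × F) ∈ 𝒱 :=
    (Continuous.prodMk_left (0 : F)).continuousAt.preimage_mem_nhds (h𝒱.mem_nhds hx₀)
  filter_upwards [hev1, hev2] with u hu1 hu2 hue
  obtain ⟨p', hp'⟩ := hue
  have hp'𝒯 : p' ∈ e ⁻¹' 𝒯 := by show e p' ∈ 𝒯; rw [hp']; exact hu1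
  rw [h𝒯] at hp'𝒯
  obtain ⟨z', hz'𝒪, hz'⟩ := hp'𝒯
  have hZ : Z ((z'.1, γ z'.1), z'.2) = Z (u, 0) := by
    rw [hsheet, hcore, ← hp', ← hz', hℓ]
  have heq := hinj hz'𝒪.2 hu2 hZ
  have h1 : z'.1 = u.1 := by
    have := congrArg (fun q : (ℝ × ℝ) × F => q.1.1) heq
    simpa using this
  have h2 : γ z'.1 = u.2 := by
    have := congrArg (fun q : (ℝ × ℝ) × F => q.1.2) heq
    simpa using this
  rw [← h2, h1]

/-! ### The core germ along the boundary -/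

section Core

variable {n N : ℕ} {V : Type*} [TopologicalSpace V] [T2Space V]
  [ChartedSpace (EuclideanSpace ℝ (Fin n)) V] [IsManifold (𝓡 n) ∞ V]
  {F₁ F₂ : Type*} [NormedAddCommGroup F₁] [NormedSpace ℝ F₁] [FiniteDimensional ℝ F₁]
  [NormedAddCommGroup F₂] [NormedSpace ℝ F₂] [FiniteDimensional ℝ F₂]
  {P Q : Type*} [TopologicalSpace P] [TopologicalSpace Q]


omit [T2Space V] [IsManifold (𝓡 n) ∞ V] in
/-- **`r ∘ g` is locally injective where its differential is injective** (`g` smooth into the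
tube, `r` the retraction): read through `ι`, the map `ι ∘ r ∘ g` between vector spaces has
injective strict derivative there (Hirsch (1976), Ch. 2 §1, Lemma 1.3). [folklore] -/
theorem exists_nhds_injOn_retraction_comp {ι : V → EuclideanSpace ℝ (Fin N)}
    (hι : ContMDiff (𝓡 n) 𝓘(ℝ, EuclideanSpace ℝ (Fin N)) ∞ ι)
    (hιimm : ∀ v, Injective (mfderiv (𝓡 n) 𝓘(ℝ, EuclideanSpace ℝ (Fin N)) ι v))
    {T : Set (EuclideanSpace ℝ (Fin N))} {rV : EuclideanSpace ℝ (Fin N) → V} (hT : IsOpen T)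
    (hr : ContMDiffOn 𝓘(ℝ, EuclideanSpace ℝ (Fin N)) (𝓡 n) ∞ rV T)
    {X : Type*} [NormedAddCommGroup X] [NormedSpace ℝ X] [FiniteDimensional ℝ X]
    {g : X → EuclideanSpace ℝ (Fin N)} (hg : ContDiff ℝ ∞ g) {u : X} (hgu : g u ∈ T)
    (hinj : Injective (mfderiv 𝓘(ℝ, X) (𝓡 n) (rV ∘ g) u)) :
    ∃ U ∈ 𝓝 u, InjOn (rV ∘ g) U := by
  set S : Set X := g ⁻¹' T with hS
  have hSo : IsOpen S := hT.preimage hg.continuous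
  have huS : u ∈ S := hgu
  have hrg : ContMDiffOn 𝓘(ℝ, X) (𝓡 n) ∞ (rV ∘ g) S :=
    hr.comp hg.contMDiff.contMDiffOn fun x hx => hx
  have hΨ : ContDiffOn ℝ ∞ (ι ∘ (rV ∘ g)) S := by
    rw [← contMDiffOn_iff_contDiffOn]; exact hι.comp_contMDiffOn hrg
  have hrgd : MDifferentiableAt 𝓘(ℝ, X) (𝓡 n) (rV ∘ g) u :=
    (hrg.contMDiffAt (hSo.mem_nhds huS)).mdifferentiableAt (by simp)
  have hιd : MDifferentiableAt (𝓡 n) 𝓘(ℝ, EuclideanSpace ℝ (Fin N)) ι ((rV ∘ g) u) :=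
    (hι _).mdifferentiableAt (by simp)
  have hder : fderiv ℝ (ι ∘ (rV ∘ g)) u =
      (mfderiv (𝓡 n) 𝓘(ℝ, EuclideanSpace ℝ (Fin N)) ι ((rV ∘ g) u)).comp
        (mfderiv 𝓘(ℝ, X) (𝓡 n) (rV ∘ g) u) := by
    rw [← mfderiv_eq_fderiv]
    exact (hιd.hasMFDerivAt.comp u hrgd.hasMFDerivAt).mfderiv
  have hinjΨ : Injective (fderiv ℝ (ι ∘ (rV ∘ g)) u) := by
    rw [hder]
    exact (hιimm _).comp hinj
  have hstrict : HasStrictFDerivAt (ι ∘ (rV ∘ g)) (fderiv ℝ (ι ∘ (rV ∘ g)) u) u :=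
    (hΨ.contDiffAt (hSo.mem_nhds huS)).hasStrictFDerivAt (by simp)
  obtain ⟨U, hU, hinjU⟩ := exists_nhds_injOn_of_injective_fderiv hstrict hinjΨ
  exact ⟨U, hU, fun a ha b hb hab => hinjU ha hb (by simp only [comp_apply] at hab ⊢; rw [hab])⟩

set_option maxHeartbeats 1600000 in
/-- **The germ of the Whitney disc along its boundary** (Milnor 1965, proof of Lemma 6.7, PDF
pp. 41–43, metric-free).  Data: a smooth immersion `ι : V → ℝᴺ` of the `n`-manifold
`V` with a smooth retraction `r` of an open neighbourhood `T ⊇ ι(V)` (`r ∘ ι = id`, `dr` killing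
the normal spaces); embeddings `e : P → V`, `e' : Q → V` with closed images `M`, `M'`; product
neighbourhoods `Λ₁ : ℝ × F₁ → P`, `Λ₂ : ℝ × F₂ → Q` (injective local homeomorphisms, `e ∘ Λ₁`,
`e' ∘ Λ₂` smooth immersions) of the arcs `C = e(Λ₁(·, 0))`, `C' = e'(Λ₂(·, 0))` from
`p = C(-1) = C'(-1)` to `q = C(1) = C'(1)`, meeting `M'` resp. `M` only at the two corners, with
`T_p M ∩ T_p M' = 0 = T_q M ∩ T_q M'` and `dim M + 2 ≤ n`, `dim M' + 2 ≤ n`.  Conclusion: a smooth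
`φ̂ : ℝ × ℝ → ℝᴺ` with `φ̂(x, x² - 1) = ι C(x)`, `φ̂(x, 0) = ι C'(x)` for all `x`, and an open
`𝒰 ⊇ ∂D̄ = {y = x² - 1, |x| ≤ 1} ∪ {y = 0, |x| ≤ 1}` mapped by `φ̂` into `T`, on which
`Φ = r ∘ φ̂` is smooth, injective, immersive, meets `M = e(P)` only on the parabola and
`M' = e'(Q)` only on the axis; and along both arcs the frame condition of Lemma 6.7: the
differential of `ι ∘ Φ` together with the fibre derivative of `ι ∘ e ∘ Λ₁` (resp.
`ι ∘ e' ∘ Λ₂`) is injective.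
[cite: MilnorHCobordism1965, proof of Lemma 6.7 (PDF pp. 41–43)] -/
theorem exists_whitneyCollarCore {ι : V → EuclideanSpace ℝ (Fin N)}
    (hι : ContMDiff (𝓡 n) 𝓘(ℝ, EuclideanSpace ℝ (Fin N)) ∞ ι)
    (hιimm : ∀ v, Injective (mfderiv (𝓡 n) 𝓘(ℝ, EuclideanSpace ℝ (Fin N)) ι v))
    {T : Set (EuclideanSpace ℝ (Fin N))} {rV : EuclideanSpace ℝ (Fin N) → V} (hT : IsOpen T)
    (hr : ContMDiffOn 𝓘(ℝ, EuclideanSpace ℝ (Fin N)) (𝓡 n) ∞ rV T) (hιT : ∀ v, ι v ∈ T)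
    (hrι : ∀ v, rV (ι v) = v)
    (hrN : ∀ v, ∀ w ∈ (tangentPlane (𝓡 n) ι v)ᗮ,
      mfderiv 𝓘(ℝ, EuclideanSpace ℝ (Fin N)) (𝓡 n) rV (ι v) w = 0)
    (hnN : n ≤ N)
    {e : P → V} (he : IsEmbedding e) (heC : IsClosed (range e))
    {Λ₁ : ℝ × F₁ → P} (hΛ₁ : IsLocalHomeomorph Λ₁) (hΛ₁i : Injective Λ₁)
    (hm₁ : ContMDiff 𝓘(ℝ, ℝ × F₁) (𝓡 n) ∞ (e ∘ Λ₁))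
    (hm₁i : ∀ z, Injective (mfderiv 𝓘(ℝ, ℝ × F₁) (𝓡 n) (e ∘ Λ₁) z))
    {e' : Q → V} (he' : IsEmbedding e') (he'C : IsClosed (range e'))
    {Λ₂ : ℝ × F₂ → Q} (hΛ₂ : IsLocalHomeomorph Λ₂) (hΛ₂i : Injective Λ₂)
    (hm₂ : ContMDiff 𝓘(ℝ, ℝ × F₂) (𝓡 n) ∞ (e' ∘ Λ₂))
    (hm₂i : ∀ z, Injective (mfderiv 𝓘(ℝ, ℝ × F₂) (𝓡 n) (e' ∘ Λ₂) z))
    (hpa : e (Λ₁ (-1, 0)) = e' (Λ₂ (-1, 0))) (hqb : e (Λ₁ (1, 0)) = e' (Λ₂ (1, 0)))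
    (hdp₁ : ∀ z, e (Λ₁ z) ∈ range e' → z = (-1, 0) ∨ z = (1, 0))
    (hdp₂ : ∀ z, e' (Λ₂ z) ∈ range e → z = (-1, 0) ∨ z = (1, 0))
    (htr : ∀ x : ℝ, x = -1 ∨ x = 1 →
      LinearMap.range (fderiv ℝ (ι ∘ e ∘ Λ₁) (x, 0) : ℝ × F₁ →ₗ[ℝ] EuclideanSpace ℝ (Fin N)) ⊓
        LinearMap.range (fderiv ℝ (ι ∘ e' ∘ Λ₂) (x, 0) : ℝ × F₂ →ₗ[ℝ] EuclideanSpace ℝ (Fin N))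
        = ⊥)
    {s₀ r₀ : ℕ} (hs₀ : 2 ≤ s₀) (hdim₁ : finrank ℝ (ℝ × F₁) + s₀ = n) (hr₀ : 2 ≤ r₀)
    (hdim₂ : finrank ℝ (ℝ × F₂) + r₀ = n) :
    ∃ (φ : ℝ × ℝ → EuclideanSpace ℝ (Fin N)) (𝒰 : Set (ℝ × ℝ)), ContDiff ℝ ∞ φ ∧ IsOpen 𝒰 ∧
      {u : ℝ × ℝ | u.1 ∈ Icc (-1 : ℝ) 1 ∧ (u.2 = u.1 ^ 2 - 1 ∨ u.2 = 0)} ⊆ 𝒰 ∧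
      (∀ x, φ (x, x ^ 2 - 1) = ι (e (Λ₁ (x, 0)))) ∧ (∀ x, φ (x, 0) = ι (e' (Λ₂ (x, 0)))) ∧
      MapsTo φ 𝒰 T ∧
      ContMDiffOn 𝓘(ℝ, ℝ × ℝ) (𝓡 n) ∞ (rV ∘ φ) 𝒰 ∧
      InjOn (rV ∘ φ) 𝒰 ∧
      (∀ u ∈ 𝒰, Injective (mfderiv 𝓘(ℝ, ℝ × ℝ) (𝓡 n) (rV ∘ φ) u)) ∧
      (∀ u ∈ 𝒰, rV (φ u) ∈ range e → u.2 = u.1 ^ 2 - 1) ∧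
      (∀ u ∈ 𝒰, rV (φ u) ∈ range e' → u.2 = 0) ∧
      (∀ x ∈ Icc (-1 : ℝ) 1, Injective fun w : (ℝ × ℝ) × F₁ =>
        fderiv ℝ (ι ∘ rV ∘ φ) (x, x ^ 2 - 1) w.1 + fderiv ℝ (ι ∘ e ∘ Λ₁) (x, 0) (0, w.2)) ∧
      (∀ x ∈ Icc (-1 : ℝ) 1, Injective fun w : (ℝ × ℝ) × F₂ =>
        fderiv ℝ (ι ∘ rV ∘ φ) (x, 0) w.1 + fderiv ℝ (ι ∘ e' ∘ Λ₂) (x, 0) (0, w.2)) := by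
  have htop : ((∞ : WithTop ℕ∞)) ≠ 0 := by simp
  ------------------------------------------------------------------------------------------
  -- Step 0: the two product neighbourhoods in the ambient space
  ------------------------------------------------------------------------------------------
  set μ : ℝ × F₁ → EuclideanSpace ℝ (Fin N) := ι ∘ e ∘ Λ₁ with hμ
  set μ' : ℝ × F₂ → EuclideanSpace ℝ (Fin N) := ι ∘ e' ∘ Λ₂ with hμ'
  have hμd : ContDiff ℝ ∞ μ := by rw [hμ, ← contMDiff_iff_contDiff]; exact hι.comp hm₁
  have hμ'd : ContDiff ℝ ∞ μ' := by rw [hμ', ← contMDiff_iff_contDiff]; exact hι.comp hm₂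
  have hμinj : ∀ z, Injective (fderiv ℝ μ z) := fun z =>
    injective_fderiv_comp_of_immersions hι hιimm hm₁ (hm₁i z)
  have hμ'inj : ∀ z, Injective (fderiv ℝ μ' z) := fun z =>
    injective_fderiv_comp_of_immersions hι hιimm hm₂ (hm₂i z)
  have hμT : ∀ z, LinearMap.range (fderiv ℝ μ z : ℝ × F₁ →ₗ[ℝ] EuclideanSpace ℝ (Fin N)) ≤
      tangentPlane (𝓡 n) ι (e (Λ₁ z)) := fun z => range_fderiv_comp_le_tangentPlane hι hm₁ z
  have hμ'T : ∀ z, LinearMap.range (fderiv ℝ μ' z : ℝ × F₂ →ₗ[ℝ] EuclideanSpace ℝ (Fin N)) ≤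
      tangentPlane (𝓡 n) ι (e' (Λ₂ z)) := fun z => range_fderiv_comp_le_tangentPlane hι hm₂ z
  -- tangents of the arcs
  set Cd : ℝ → EuclideanSpace ℝ (Fin N) := fun x => fderiv ℝ μ (x, 0) ((1 : ℝ), (0 : F₁)) with hCd
  set Cd' : ℝ → EuclideanSpace ℝ (Fin N) := fun x => fderiv ℝ μ' (x, 0) ((1 : ℝ), (0 : F₂))
    with hCd'
  have hCdR : ∀ x, Cd x ∈ LinearMap.range (fderiv ℝ μ (x, 0) : ℝ × F₁ →ₗ[ℝ] _) :=
    fun x => ⟨_, rfl⟩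
  have hCd'R : ∀ x, Cd' x ∈ LinearMap.range (fderiv ℝ μ' (x, 0) : ℝ × F₂ →ₗ[ℝ] _) :=
    fun x => ⟨_, rfl⟩
  have hCd0 : ∀ x, Cd x ≠ 0 := fun x h => by
    have := hμinj (x, 0) (h.trans (map_zero _).symm)
    simp at this
  have hCd'0 : ∀ x, Cd' x ≠ 0 := fun x h => by
    have := hμ'inj (x, 0) (h.trans (map_zero _).symm)
    simp at this
  -- the corners
  have hpa' : e' (Λ₂ (-1, 0)) = e (Λ₁ (-1, 0)) := hpa.symm
  have hqb' : e' (Λ₂ (1, 0)) = e (Λ₁ (1, 0)) := hqb.symm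
  have hp : μ (-1, 0) = μ' (-1, 0) := by simp [hμ, hμ', hpa]
  have hq : μ (1, 0) = μ' (1, 0) := by simp [hμ, hμ', hqb]
  -- the corner values of the transversal fields
  set v₀ : EuclideanSpace ℝ (Fin N) := (1 / 2 : ℝ) • (Cd' (-1) - Cd (-1)) with hv₀
  set v₁ : EuclideanSpace ℝ (Fin N) := (1 / 2 : ℝ) • (Cd 1 - Cd' 1) with hv₁
  ------------------------------------------------------------------------------------------
  -- Step 1: forbidden frames along the two arcs
  ------------------------------------------------------------------------------------------
  obtain ⟨O₁, A₁, hO₁, hIO₁, hA₁d, hA₁⟩ := exists_forbiddenFrame hι hιimm hm₁ hm₁i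
    (k := finrank ℝ (ℝ × F₁) + (N - n)) rfl hnN
  obtain ⟨O₂, A₂, hO₂, hIO₂, hA₂d, hA₂⟩ := exists_forbiddenFrame hι hιimm hm₂ hm₂i
    (k := finrank ℝ (ℝ × F₂) + (N - n)) rfl hnN
  have hm1 : (-1 : ℝ) ∈ Icc (-1 : ℝ) 1 := ⟨le_rfl, by norm_num⟩
  have hp1 : (1 : ℝ) ∈ Icc (-1 : ℝ) 1 := ⟨by norm_num, le_rfl⟩
  -- the corner values avoid the forbidden ranges
  have hv₀A₁ : v₀ ∉ LinearMap.range (A₁ (-1) : EuclideanSpace ℝ (Fin (finrank ℝ (ℝ × F₁) + (N - n))) →ₗ[ℝ] EuclideanSpace ℝ (Fin N)) := by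
    rw [(hA₁ _ (hIO₁ hm1)).2]
    refine half_sub_notMem_sup_orthogonal (hμT (-1, 0)) ?_ (htr (-1) (Or.inl rfl)) (hCdR (-1))
      (hCd'R (-1)) (hCd'0 (-1))
    rw [← hpa']; exact hμ'T (-1, 0)
  have hv₁A₁ : v₁ ∉ LinearMap.range (A₁ 1 : EuclideanSpace ℝ (Fin (finrank ℝ (ℝ × F₁) + (N - n))) →ₗ[ℝ] EuclideanSpace ℝ (Fin N)) := by
    rw [(hA₁ _ (hIO₁ hp1)).2, hv₁, ← neg_sub, smul_neg, Submodule.neg_mem_iff]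
    refine half_sub_notMem_sup_orthogonal (hμT (1, 0)) ?_ (htr 1 (Or.inr rfl)) (hCdR 1)
      (hCd'R 1) (hCd'0 1)
    rw [← hqb']; exact hμ'T (1, 0)
  have hv₀A₂ : v₀ ∉ LinearMap.range (A₂ (-1) : EuclideanSpace ℝ (Fin (finrank ℝ (ℝ × F₂) + (N - n))) →ₗ[ℝ] EuclideanSpace ℝ (Fin N)) := by
    rw [(hA₂ _ (hIO₂ hm1)).2, hv₀, ← neg_sub, smul_neg, Submodule.neg_mem_iff,
      show (e' ∘ Λ₂) (-1, 0) = e (Λ₁ (-1, 0)) from hpa']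
    refine half_sub_notMem_sup_orthogonal ?_ (hμT (-1, 0)) ?_ (hCd'R (-1)) (hCdR (-1))
      (hCd0 (-1))
    · rw [← hpa']; exact hμ'T (-1, 0)
    · rw [inf_comm]; exact htr (-1) (Or.inl rfl)
  have hv₁A₂ : v₁ ∉ LinearMap.range (A₂ 1 : EuclideanSpace ℝ (Fin (finrank ℝ (ℝ × F₂) + (N - n))) →ₗ[ℝ] EuclideanSpace ℝ (Fin N)) := by
    rw [(hA₂ _ (hIO₂ hp1)).2, show (e' ∘ Λ₂) (1, 0) = e (Λ₁ (1, 0)) from hqb']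
    refine half_sub_notMem_sup_orthogonal ?_ (hμT (1, 0)) ?_ (hCd'R 1) (hCdR 1) (hCd0 1)
    · rw [← hqb']; exact hμ'T (1, 0)
    · rw [inf_comm]; exact htr 1 (Or.inr rfl)
  ------------------------------------------------------------------------------------------
  -- Step 2: the transversal fields along the two arcs
  ------------------------------------------------------------------------------------------
  have hdimν₁ : finrank ℝ (ℝ × F₁) + (N - n) + s₀ = finrank ℝ (EuclideanSpace ℝ (Fin N)) := by
    rw [finrank_euclideanSpace_fin]; omega
  have hdimν₂ : finrank ℝ (ℝ × F₂) + (N - n) + r₀ = finrank ℝ (EuclideanSpace ℝ (Fin N)) := by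
    rw [finrank_euclideanSpace_fin]; omega
  obtain ⟨V₁, ν, hV₁o, hIV₁, hV₁O₁, hνd, hνm, hνp, hνT⟩ :=
    exists_contDiffOn_transversal_along_segment hdimν₁ hs₀ hO₁ hIO₁ hA₁d
      (fun x hx => (hA₁ x (hIO₁ hx)).1) hv₀A₁ hv₁A₁
  obtain ⟨V₂, ν', hV₂o, hIV₂, hV₂O₂, hν'd, hν'm, hν'p, hν'T⟩ :=
    exists_contDiffOn_transversal_along_segment hdimν₂ hr₀ hO₂ hIO₂ hA₂d
      (fun x hx => (hA₂ x (hIO₂ hx)).1) hv₀A₂ hv₁A₂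
  ------------------------------------------------------------------------------------------
  -- Step 3: the collar formula
  ------------------------------------------------------------------------------------------
  set O : Set ℝ := V₁ ∩ V₂ with hO
  have hOo : IsOpen O := hV₁o.inter hV₂o
  have hIO : Icc (-1 : ℝ) 1 ⊆ O := subset_inter hIV₁ hIV₂
  obtain ⟨φ, hφd, hpar, hseg, hvy₁, hvy₂⟩ := exists_whitneyCollarMap hμd hμ'd hp hq hOo hIO
    (hνd.mono inter_subset_left) (hν'd.mono inter_subset_right) hνm hνp
    (hν'm.trans hνm.symm) (hν'p.trans hνp.symm)
    (hA₁d.continuousOn.mono (inter_subset_left.trans hV₁O₁))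
    (fun x hx => (hA₁ x (hV₁O₁ hx.1)).1) hνT
    (hA₂d.continuousOn.mono (inter_subset_right.trans hV₂O₂))
    (fun x hx => (hA₂ x (hV₂O₂ hx.2)).1) hν'T
  have hφdiff : Differentiable ℝ φ := hφd.differentiable htop
  have hμdiff : Differentiable ℝ μ := hμd.differentiable htop
  have hμ'diff : Differentiable ℝ μ' := hμ'd.differentiable htop
  ------------------------------------------------------------------------------------------
  -- Step 4: first-order data of `φ` along the two arcs
  ------------------------------------------------------------------------------------------
  have hCpar : ∀ x, fderiv ℝ φ (x, x ^ 2 - 1) ((1 : ℝ), 2 * x) = Cd x := fun x => by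
    have hγ : HasDerivAt (fun x : ℝ => ((x, x ^ 2 - 1) : ℝ × ℝ)) ((1 : ℝ), 2 * x) x := by
      refine (hasDerivAt_id x).prodMk (((hasDerivAt_pow 2 x).sub_const (1 : ℝ)).congr_deriv ?_)
      norm_num
    have h1 : HasDerivAt (fun x : ℝ => φ (x, x ^ 2 - 1))
        (fderiv ℝ φ (x, x ^ 2 - 1) ((1 : ℝ), 2 * x)) x :=
      (hφdiff _).hasFDerivAt.comp_hasDerivAt x hγ
    have h2 : HasDerivAt (fun x : ℝ => μ (x, 0)) (Cd x) x := by
      have := hasDerivAt_comp_affine_core hμdiff 0 1 x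
      simpa using this
    have heq : (fun x : ℝ => φ (x, x ^ 2 - 1)) = fun x => μ (x, 0) := funext hpar
    rw [heq] at h1
    exact h1.unique h2
  have hCseg : ∀ x, fderiv ℝ φ (x, 0) ((1 : ℝ), (0 : ℝ)) = Cd' x := fun x => by
    have hγ : HasDerivAt (fun x : ℝ => ((x, 0) : ℝ × ℝ)) ((1 : ℝ), (0 : ℝ)) x :=
      (hasDerivAt_id x).prodMk (hasDerivAt_const x 0)
    have h1 : HasDerivAt (fun x : ℝ => φ (x, 0)) (fderiv ℝ φ (x, 0) ((1 : ℝ), (0 : ℝ))) x :=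
      (hφdiff _).hasFDerivAt.comp_hasDerivAt x hγ
    have h2 : HasDerivAt (fun x : ℝ => μ' (x, 0)) (Cd' x) x := by
      have := hasDerivAt_comp_affine_core hμ'diff 0 1 x
      simpa using this
    have heq : (fun x : ℝ => φ (x, 0)) = fun x => μ' (x, 0) := funext hseg
    rw [heq] at h1
    exact h1.unique h2
  -- no kernel modulo the normal space: the parabola
  have hker₁ : ∀ x ∈ Icc (-1 : ℝ) 1, ∀ w : (ℝ × ℝ) × F₁,
      fderiv ℝ φ (x, x ^ 2 - 1) w.1 + fderiv ℝ μ (x, 0) (0, w.2) ∈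
        (tangentPlane (𝓡 n) ι (e (Λ₁ (x, 0))))ᗮ → w = 0 := by
    rintro x hx ⟨⟨h, k⟩, f⟩ hw
    set vy : EuclideanSpace ℝ (Fin N) := fderiv ℝ φ (x, x ^ 2 - 1) ((0 : ℝ), (1 : ℝ)) with hvy
    have hdec : ((h, k) : ℝ × ℝ) = h • ((1 : ℝ), 2 * x) + (k - 2 * x * h) • ((0 : ℝ), (1 : ℝ)) := by
      refine Prod.ext (by simp) ?_
      simp only [Prod.snd_add, Prod.smul_mk, smul_eq_mul, mul_one]
      ring
    have hφw : fderiv ℝ φ (x, x ^ 2 - 1) (h, k) = h • Cd x + (k - 2 * x * h) • vy := by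
      rw [hdec, map_add, map_smul, map_smul, hCpar]
    have hμw : fderiv ℝ μ (x, 0) ((h : ℝ), f) = h • Cd x + fderiv ℝ μ (x, 0) (0, f) := by
      have : ((h, f) : ℝ × F₁) = h • ((1 : ℝ), (0 : F₁)) + ((0 : ℝ), f) := by ext <;> simp
      rw [this, map_add, map_smul]
    have htot : fderiv ℝ φ (x, x ^ 2 - 1) (h, k) + fderiv ℝ μ (x, 0) (0, f) =
        fderiv ℝ μ (x, 0) (h, f) + (k - 2 * x * h) • vy := by
      rw [hφw, hμw]; abel
    change fderiv ℝ φ (x, x ^ 2 - 1) (h, k) + fderiv ℝ μ (x, 0) (0, f) ∈ _ at hw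
    rw [htot] at hw
    have hRT := hμT (x, 0)
    have hcoef : k - 2 * x * h = 0 := by
      by_contra hne
      apply hvy₁ x hx
      rw [(hA₁ x (hIO₁ hx)).2]
      have : vy = (k - 2 * x * h)⁻¹ •
          ((fderiv ℝ μ (x, 0) (h, f) + (k - 2 * x * h) • vy) - fderiv ℝ μ (x, 0) (h, f)) := by
        rw [add_sub_cancel_left, smul_smul, inv_mul_cancel₀ hne, one_smul]
      change vy ∈ _
      rw [this]
      exact Submodule.smul_mem _ _
        (Submodule.sub_mem _ (Submodule.mem_sup_right hw) (Submodule.mem_sup_left ⟨_, rfl⟩))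
    have htot0 : fderiv ℝ μ (x, 0) (h, f) = 0 := by
      rw [hcoef, zero_smul, add_zero] at hw
      have hmem : fderiv ℝ μ (x, 0) (h, f) ∈ tangentPlane (𝓡 n) ι (e (Λ₁ (x, 0))) ⊓
          (tangentPlane (𝓡 n) ι (e (Λ₁ (x, 0))))ᗮ := ⟨hRT ⟨_, rfl⟩, hw⟩
      rw [Submodule.inf_orthogonal_eq_bot, Submodule.mem_bot] at hmem
      exact hmem
    have hhf : ((h, f) : ℝ × F₁) = 0 := hμinj (x, 0) (htot0.trans (map_zero _).symm)
    have hh : h = 0 := congrArg Prod.fst hhf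
    have hf : f = 0 := congrArg Prod.snd hhf
    have hk : k = 0 := by rw [hh] at hcoef; linarith
    simp [hh, hf, hk]
  -- no kernel modulo the normal space: the axis
  have hker₂ : ∀ x ∈ Icc (-1 : ℝ) 1, ∀ w : (ℝ × ℝ) × F₂,
      fderiv ℝ φ (x, 0) w.1 + fderiv ℝ μ' (x, 0) (0, w.2) ∈
        (tangentPlane (𝓡 n) ι (e' (Λ₂ (x, 0))))ᗮ → w = 0 := by
    rintro x hx ⟨⟨h, k⟩, f⟩ hw
    set vy : EuclideanSpace ℝ (Fin N) := fderiv ℝ φ (x, 0) ((0 : ℝ), (1 : ℝ)) with hvy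
    have hdec : ((h, k) : ℝ × ℝ) = h • ((1 : ℝ), (0 : ℝ)) + k • ((0 : ℝ), (1 : ℝ)) := by
      ext <;> simp
    have hφw : fderiv ℝ φ (x, 0) (h, k) = h • Cd' x + k • vy := by
      rw [hdec, map_add, map_smul, map_smul, hCseg]
    have hμw : fderiv ℝ μ' (x, 0) ((h : ℝ), f) = h • Cd' x + fderiv ℝ μ' (x, 0) (0, f) := by
      have : ((h, f) : ℝ × F₂) = h • ((1 : ℝ), (0 : F₂)) + ((0 : ℝ), f) := by ext <;> simp
      rw [this, map_add, map_smul]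
    have htot : fderiv ℝ φ (x, 0) (h, k) + fderiv ℝ μ' (x, 0) (0, f) =
        fderiv ℝ μ' (x, 0) (h, f) + k • vy := by
      rw [hφw, hμw]; abel
    change fderiv ℝ φ (x, 0) (h, k) + fderiv ℝ μ' (x, 0) (0, f) ∈ _ at hw
    rw [htot] at hw
    have hRT := hμ'T (x, 0)
    have hcoef : k = 0 := by
      by_contra hne
      apply hvy₂ x hx
      rw [(hA₂ x (hIO₂ hx)).2]
      have : vy = k⁻¹ • ((fderiv ℝ μ' (x, 0) (h, f) + k • vy) - fderiv ℝ μ' (x, 0) (h, f)) := by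
        rw [add_sub_cancel_left, smul_smul, inv_mul_cancel₀ hne, one_smul]
      change vy ∈ _
      rw [this]
      exact Submodule.smul_mem _ _
        (Submodule.sub_mem _ (Submodule.mem_sup_right hw) (Submodule.mem_sup_left ⟨_, rfl⟩))
    have htot0 : fderiv ℝ μ' (x, 0) (h, f) = 0 := by
      rw [hcoef, zero_smul, add_zero] at hw
      have hmem : fderiv ℝ μ' (x, 0) (h, f) ∈ tangentPlane (𝓡 n) ι (e' (Λ₂ (x, 0))) ⊓
          (tangentPlane (𝓡 n) ι (e' (Λ₂ (x, 0))))ᗮ := ⟨hRT ⟨_, rfl⟩, hw⟩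
      rw [Submodule.inf_orthogonal_eq_bot, Submodule.mem_bot] at hmem
      exact hmem
    have hhf : ((h, f) : ℝ × F₂) = 0 := hμ'inj (x, 0) (htot0.trans (map_zero _).symm)
    have hh : h = 0 := congrArg Prod.fst hhf
    have hf : f = 0 := congrArg Prod.snd hhf
    simp [hh, hf, hcoef]
  ------------------------------------------------------------------------------------------
  -- Step 5: `Φ = r ∘ φ`, its smoothness set and its immersion set
  ------------------------------------------------------------------------------------------
  set Φ : ℝ × ℝ → V := rV ∘ φ with hΦ
  have hΦpar : ∀ x, Φ (x, x ^ 2 - 1) = e (Λ₁ (x, 0)) := fun x => by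
    show rV (φ (x, x ^ 2 - 1)) = _; rw [hpar]; exact hrι _
  have hΦseg : ∀ x, Φ (x, 0) = e' (Λ₂ (x, 0)) := fun x => by
    show rV (φ (x, 0)) = _; rw [hseg]; exact hrι _
  -- injective differential at the points of the two arcs
  have hΦdpar : ∀ x ∈ Icc (-1 : ℝ) 1,
      Injective (mfderiv 𝓘(ℝ, ℝ × ℝ) (𝓡 n) Φ (x, x ^ 2 - 1)) := fun x hx =>
    injective_mfderiv_retraction_comp hι hT hr hιT hrι hrN (hφdiff _) (v := e (Λ₁ (x, 0)))
      (hpar x) fun w hw => by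
        have := hker₁ x hx (w, 0) (by
          rw [show ((0 : ℝ), ((w, (0 : F₁)) : (ℝ × ℝ) × F₁).2) = (0 : ℝ × F₁) from rfl, map_zero,
            add_zero]
          exact hw)
        exact congrArg Prod.fst this
  have hΦdseg : ∀ x ∈ Icc (-1 : ℝ) 1, Injective (mfderiv 𝓘(ℝ, ℝ × ℝ) (𝓡 n) Φ (x, 0)) :=
    fun x hx =>
    injective_mfderiv_retraction_comp hι hT hr hιT hrι hrN (hφdiff _) (v := e' (Λ₂ (x, 0)))
      (hseg x) fun w hw => by
        have := hker₂ x hx (w, 0) (by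
          rw [show ((0 : ℝ), ((w, (0 : F₂)) : (ℝ × ℝ) × F₂).2) = (0 : ℝ × F₂) from rfl, map_zero,
            add_zero]
          exact hw)
        exact congrArg Prod.fst this
  -- where `φ` lands in the tube
  set Usm : Set (ℝ × ℝ) := φ ⁻¹' T with hUsm
  have hUsmo : IsOpen Usm := hT.preimage hφd.continuous
  have hΦsm : ContMDiffOn 𝓘(ℝ, ℝ × ℝ) (𝓡 n) ∞ Φ Usm :=
    hr.comp hφd.contMDiff.contMDiffOn fun u hu => hu
  have hΨsm : ContDiffOn ℝ ∞ (ι ∘ Φ) Usm := by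
    rw [← contMDiffOn_iff_contDiffOn]; exact hι.comp_contMDiffOn hΦsm
  have hΨder : ∀ u ∈ Usm, fderiv ℝ (ι ∘ Φ) u =
      (mfderiv (𝓡 n) 𝓘(ℝ, EuclideanSpace ℝ (Fin N)) ι (Φ u)).comp
        (mfderiv 𝓘(ℝ, ℝ × ℝ) (𝓡 n) Φ u) := fun u hu => by
    have hΦd : MDifferentiableAt 𝓘(ℝ, ℝ × ℝ) (𝓡 n) Φ u :=
      (hΦsm.contMDiffAt (hUsmo.mem_nhds hu)).mdifferentiableAt (by simp)
    have hιd : MDifferentiableAt (𝓡 n) 𝓘(ℝ, EuclideanSpace ℝ (Fin N)) ι (Φ u) :=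
      (hι _).mdifferentiableAt (by simp)
    rw [← mfderiv_eq_fderiv]
    exact (hιd.hasMFDerivAt.comp u hΦd.hasMFDerivAt).mfderiv
  -- the immersion set
  set Uimm : Set (ℝ × ℝ) := Usm ∩ fderiv ℝ (ι ∘ Φ) ⁻¹' {L | Injective L} with hUimm
  have hUimmo : IsOpen Uimm :=
    (hΨsm.continuousOn_fderiv_of_isOpen hUsmo (by simp)).isOpen_inter_preimage hUsmo
      ContinuousLinearMap.isOpen_injective
  have himm : ∀ u ∈ Uimm, Injective (mfderiv 𝓘(ℝ, ℝ × ℝ) (𝓡 n) Φ u) := fun u hu => by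
    have h : Injective (fderiv ℝ (ι ∘ Φ) u) := hu.2
    rw [hΨder u hu.1] at h
    exact fun a b hab =>
      h (congrArg (mfderiv (𝓡 n) 𝓘(ℝ, EuclideanSpace ℝ (Fin N)) ι (Φ u)) hab)
  have hloc : ∀ u ∈ Uimm, ∃ U ∈ 𝓝 u, InjOn Φ U := fun u hu =>
    exists_nhds_injOn_retraction_comp hι hιimm hT hr hφd hu.1 (himm u hu)
  -- the boundary of the disc lies in the immersion set
  set Kb : Set (ℝ × ℝ) := (fun x : ℝ => ((x, x ^ 2 - 1) : ℝ × ℝ)) '' Icc (-1) 1 ∪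
    (fun x : ℝ => ((x, 0) : ℝ × ℝ)) '' Icc (-1) 1 with hKb
  have hKbc : IsCompact Kb :=
    (isCompact_Icc.image (by fun_prop)).union (isCompact_Icc.image (by fun_prop))
  have hKbUsm : Kb ⊆ Usm := by
    rintro u (⟨x, -, rfl⟩ | ⟨x, -, rfl⟩)
    · show φ (x, x ^ 2 - 1) ∈ T; rw [hpar]; exact hιT _
    · show φ (x, 0) ∈ T; rw [hseg]; exact hιT _
  have hKbUimm : Kb ⊆ Uimm := by
    intro u hu
    refine ⟨hKbUsm hu, ?_⟩
    show Injective (fderiv ℝ (ι ∘ Φ) u)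
    rw [hΨder u (hKbUsm hu)]
    rcases hu with ⟨x, hx, rfl⟩ | ⟨x, hx, rfl⟩
    · exact (hιimm _).comp (hΦdpar x hx)
    · exact (hιimm _).comp (hΦdseg x hx)
  ------------------------------------------------------------------------------------------
  -- Step 6: injectivity near the boundary
  ------------------------------------------------------------------------------------------
  have hinjKb : InjOn Φ Kb := by
    -- a mixed coincidence happens only at a corner
    have hmixed : ∀ x x' : ℝ, e (Λ₁ (x, 0)) = e' (Λ₂ (x', 0)) →
        ((x, x ^ 2 - 1) : ℝ × ℝ) = (x', 0) := by
      intro x x' hxx'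
      have h1 := hdp₁ (x, 0) ⟨_, hxx'.symm⟩
      rcases h1 with h1 | h1
      · have hx : x = -1 := congrArg Prod.fst h1
        rw [hx, hpa] at hxx'
        have hx' : x' = -1 := by
          have := hΛ₂i (he'.injective hxx'.symm)
          exact congrArg Prod.fst this
        rw [hx, hx']; norm_num
      · have hx : x = 1 := congrArg Prod.fst h1
        rw [hx, hqb] at hxx'
        have hx' : x' = 1 := by
          have := hΛ₂i (he'.injective hxx'.symm)
          exact congrArg Prod.fst this
        rw [hx, hx']; norm_num
    rintro u (⟨x, -, rfl⟩ | ⟨x, -, rfl⟩) u' (⟨x', -, rfl⟩ | ⟨x', -, rfl⟩) huu'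
    · rw [hΦpar, hΦpar] at huu'
      have := congrArg Prod.fst (hΛ₁i (he.injective huu'))
      simp only at this; rw [this]
    · rw [hΦpar, hΦseg] at huu'
      exact hmixed x x' huu'
    · rw [hΦseg, hΦpar] at huu'
      exact (hmixed x' x huu'.symm).symm
    · rw [hΦseg, hΦseg] at huu'
      have := congrArg Prod.fst (hΛ₂i (he'.injective huu'))
      simp only at this; rw [this]
  obtain ⟨Uinj, hUinjo, hKbUinj, hinjU⟩ := exists_isOpen_injOn_of_isCompact hKbc
    (fun u hu => (hΦsm.continuousOn.continuousAt (hUsmo.mem_nhds (hKbUsm hu))))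
    hinjKb (fun u hu => hloc u (hKbUimm hu))
  ------------------------------------------------------------------------------------------
  -- Step 7: the disc meets `M` only along the parabola and `M'` only along the axis
  ------------------------------------------------------------------------------------------
  -- the sheet through the parabola
  set G₁ : (ℝ × ℝ) × F₁ → EuclideanSpace ℝ (Fin N) := fun pw =>
    φ pw.1 + μ (pw.1.1, pw.2) - μ (pw.1.1, 0) with hG₁
  have hG₁d : ContDiff ℝ ∞ G₁ :=
    ((hφd.comp contDiff_fst).add
      (hμd.comp ((contDiff_fst.comp contDiff_fst).prodMk contDiff_snd))).sub
      (hμd.comp ((contDiff_fst.comp contDiff_fst).prodMk contDiff_const))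
  have hG₁par : ∀ x w, G₁ ((x, x ^ 2 - 1), w) = μ (x, w) := fun x w => by
    simp only [hG₁, hpar]; abel
  have hG₁core : ∀ u, G₁ (u, 0) = φ u := fun u => by simp only [hG₁]; abel
  have hG₁der : ∀ x (w : (ℝ × ℝ) × F₁), fderiv ℝ G₁ ((x, x ^ 2 - 1), 0) w =
      fderiv ℝ φ (x, x ^ 2 - 1) w.1 + fderiv ℝ μ (x, 0) (0, w.2) := fun x w => by
    set pt : (ℝ × ℝ) × F₁ := ((x, x ^ 2 - 1), 0) with hpt
    set αL : (ℝ × ℝ) × F₁ →L[ℝ] ℝ × F₁ :=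
      ((ContinuousLinearMap.fst ℝ ℝ ℝ).comp (ContinuousLinearMap.fst ℝ (ℝ × ℝ) F₁)).prod
        (ContinuousLinearMap.snd ℝ (ℝ × ℝ) F₁) with hαL
    set βL : (ℝ × ℝ) × F₁ →L[ℝ] ℝ × F₁ :=
      ((ContinuousLinearMap.fst ℝ ℝ ℝ).comp (ContinuousLinearMap.fst ℝ (ℝ × ℝ) F₁)).prod 0
      with hβL
    have h1 : HasFDerivAt (fun pw : (ℝ × ℝ) × F₁ => φ pw.1)
        ((fderiv ℝ φ (x, x ^ 2 - 1)).comp (ContinuousLinearMap.fst ℝ (ℝ × ℝ) F₁)) pt :=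
      (hφdiff _).hasFDerivAt.comp pt hasFDerivAt_fst
    have h2 : HasFDerivAt (fun pw : (ℝ × ℝ) × F₁ => μ (pw.1.1, pw.2))
        ((fderiv ℝ μ (x, 0)).comp αL) pt :=
      (hμdiff _).hasFDerivAt.comp pt αL.hasFDerivAt
    have h3 : HasFDerivAt (fun pw : (ℝ × ℝ) × F₁ => μ (pw.1.1, 0))
        ((fderiv ℝ μ (x, 0)).comp βL) pt :=
      (hμdiff _).hasFDerivAt.comp pt βL.hasFDerivAt
    have hG : HasFDerivAt G₁ ((fderiv ℝ φ (x, x ^ 2 - 1)).comp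
        (ContinuousLinearMap.fst ℝ (ℝ × ℝ) F₁) + (fderiv ℝ μ (x, 0)).comp αL -
        (fderiv ℝ μ (x, 0)).comp βL) pt := (h1.add h2).sub h3
    rw [hG.fderiv]
    simp only [sub_apply, add_apply, ContinuousLinearMap.coe_comp, comp_apply,
      ContinuousLinearMap.coe_fst', ContinuousLinearMap.coe_snd', hαL, hβL,
      ContinuousLinearMap.prod_apply, zero_apply]
    rw [add_sub_assoc, ← map_sub, Prod.mk_sub_mk, sub_self, sub_zero]
  have hZ₁sheet : ∀ x w, (rV ∘ G₁) ((x, x ^ 2 - 1), w) = e (Λ₁ (x, w)) := fun x w => by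
    show rV (G₁ _) = _; rw [hG₁par]; exact hrι _
  have hZ₁core : ∀ u, (rV ∘ G₁) (u, 0) = Φ u := fun u => by
    show rV (G₁ (u, 0)) = rV (φ u); rw [hG₁core]
  have hZ₁inj : ∀ x ∈ Icc (-1 : ℝ) 1,
      Injective (mfderiv 𝓘(ℝ, (ℝ × ℝ) × F₁) (𝓡 n) (rV ∘ G₁) ((x, x ^ 2 - 1), 0)) := fun x hx =>
    injective_mfderiv_retraction_comp hι hT hr hιT hrι hrN (hG₁d.differentiable htop _)
      (v := e (Λ₁ (x, 0))) (hG₁par x 0) fun w hw => hker₁ x hx w (by rwa [hG₁der] at hw)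
  set Kp : Set ((ℝ × ℝ) × F₁) := (fun x : ℝ => (((x, x ^ 2 - 1), 0) : (ℝ × ℝ) × F₁)) '' Icc (-1) 1
    with hKp
  have hKpc : IsCompact Kp := isCompact_Icc.image (by fun_prop)
  have hKpT : ∀ x, G₁ ((x, x ^ 2 - 1), 0) ∈ T := fun x => by rw [hG₁par]; exact hιT _
  obtain ⟨𝒱₁, h𝒱₁o, hK𝒱₁, hinj𝒱₁⟩ := exists_isOpen_injOn_of_isCompact hKpc
    (fun pw hpw => by
      obtain ⟨x, -, rfl⟩ := hpw
      exact ((hr.continuousOn.continuousAt (hT.mem_nhds (hKpT x))).comp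
        hG₁d.continuous.continuousAt))
    (by
      rintro _ ⟨x, -, rfl⟩ _ ⟨x', -, rfl⟩ h
      rw [hZ₁sheet, hZ₁sheet] at h
      have := congrArg Prod.fst (hΛ₁i (he.injective h))
      simp only at this; rw [this])
    (fun pw hpw => by
      obtain ⟨x, hx, rfl⟩ := hpw
      exact exists_nhds_injOn_retraction_comp hι hιimm hT hr hG₁d (hKpT x) (hZ₁inj x hx))
  -- the sheet through the axis
  set G₂ : (ℝ × ℝ) × F₂ → EuclideanSpace ℝ (Fin N) := fun pw =>
    φ pw.1 + μ' (pw.1.1, pw.2) - μ' (pw.1.1, 0) with hG₂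
  have hG₂d : ContDiff ℝ ∞ G₂ :=
    ((hφd.comp contDiff_fst).add
      (hμ'd.comp ((contDiff_fst.comp contDiff_fst).prodMk contDiff_snd))).sub
      (hμ'd.comp ((contDiff_fst.comp contDiff_fst).prodMk contDiff_const))
  have hG₂seg : ∀ x w, G₂ ((x, 0), w) = μ' (x, w) := fun x w => by
    simp only [hG₂, hseg]; abel
  have hG₂core : ∀ u, G₂ (u, 0) = φ u := fun u => by simp only [hG₂]; abel
  have hG₂der : ∀ x (w : (ℝ × ℝ) × F₂), fderiv ℝ G₂ ((x, 0), 0) w =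
      fderiv ℝ φ (x, 0) w.1 + fderiv ℝ μ' (x, 0) (0, w.2) := fun x w => by
    set pt : (ℝ × ℝ) × F₂ := ((x, 0), 0) with hpt
    set αL : (ℝ × ℝ) × F₂ →L[ℝ] ℝ × F₂ :=
      ((ContinuousLinearMap.fst ℝ ℝ ℝ).comp (ContinuousLinearMap.fst ℝ (ℝ × ℝ) F₂)).prod
        (ContinuousLinearMap.snd ℝ (ℝ × ℝ) F₂) with hαL
    set βL : (ℝ × ℝ) × F₂ →L[ℝ] ℝ × F₂ :=
      ((ContinuousLinearMap.fst ℝ ℝ ℝ).comp (ContinuousLinearMap.fst ℝ (ℝ × ℝ) F₂)).prod 0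
      with hβL
    have h1 : HasFDerivAt (fun pw : (ℝ × ℝ) × F₂ => φ pw.1)
        ((fderiv ℝ φ (x, 0)).comp (ContinuousLinearMap.fst ℝ (ℝ × ℝ) F₂)) pt :=
      (hφdiff _).hasFDerivAt.comp pt hasFDerivAt_fst
    have h2 : HasFDerivAt (fun pw : (ℝ × ℝ) × F₂ => μ' (pw.1.1, pw.2))
        ((fderiv ℝ μ' (x, 0)).comp αL) pt :=
      (hμ'diff _).hasFDerivAt.comp pt αL.hasFDerivAt
    have h3 : HasFDerivAt (fun pw : (ℝ × ℝ) × F₂ => μ' (pw.1.1, 0))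
        ((fderiv ℝ μ' (x, 0)).comp βL) pt :=
      (hμ'diff _).hasFDerivAt.comp pt βL.hasFDerivAt
    have hG : HasFDerivAt G₂ ((fderiv ℝ φ (x, 0)).comp
        (ContinuousLinearMap.fst ℝ (ℝ × ℝ) F₂) + (fderiv ℝ μ' (x, 0)).comp αL -
        (fderiv ℝ μ' (x, 0)).comp βL) pt := (h1.add h2).sub h3
    rw [hG.fderiv]
    simp only [sub_apply, add_apply, ContinuousLinearMap.coe_comp, comp_apply,
      ContinuousLinearMap.coe_fst', ContinuousLinearMap.coe_snd', hαL, hβL,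
      ContinuousLinearMap.prod_apply, zero_apply]
    rw [add_sub_assoc, ← map_sub, Prod.mk_sub_mk, sub_self, sub_zero]
  have hZ₂sheet : ∀ x w, (rV ∘ G₂) ((x, (fun _ : ℝ => (0 : ℝ)) x), w) = e' (Λ₂ (x, w)) :=
    fun x w => by show rV (G₂ ((x, 0), w)) = _; rw [hG₂seg]; exact hrι _
  have hZ₂core : ∀ u, (rV ∘ G₂) (u, 0) = Φ u := fun u => by
    show rV (G₂ (u, 0)) = rV (φ u); rw [hG₂core]
  have hZ₂inj : ∀ x ∈ Icc (-1 : ℝ) 1,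
      Injective (mfderiv 𝓘(ℝ, (ℝ × ℝ) × F₂) (𝓡 n) (rV ∘ G₂) ((x, 0), 0)) := fun x hx =>
    injective_mfderiv_retraction_comp hι hT hr hιT hrι hrN (hG₂d.differentiable htop _)
      (v := e' (Λ₂ (x, 0))) (hG₂seg x 0) fun w hw => hker₂ x hx w (by rwa [hG₂der] at hw)
  set Ks : Set ((ℝ × ℝ) × F₂) := (fun x : ℝ => (((x, 0), 0) : (ℝ × ℝ) × F₂)) '' Icc (-1) 1
    with hKs
  have hKsc : IsCompact Ks := isCompact_Icc.image (by fun_prop)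
  have hKsT : ∀ x, G₂ ((x, 0), 0) ∈ T := fun x => by rw [hG₂seg]; exact hιT _
  obtain ⟨𝒱₂, h𝒱₂o, hK𝒱₂, hinj𝒱₂⟩ := exists_isOpen_injOn_of_isCompact hKsc
    (fun pw hpw => by
      obtain ⟨x, -, rfl⟩ := hpw
      exact ((hr.continuousOn.continuousAt (hT.mem_nhds (hKsT x))).comp
        hG₂d.continuous.continuousAt))
    (by
      rintro _ ⟨x, -, rfl⟩ _ ⟨x', -, rfl⟩ h
      have h' : (rV ∘ G₂) ((x, (fun _ : ℝ => (0 : ℝ)) x), 0) =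
          (rV ∘ G₂) ((x', (fun _ : ℝ => (0 : ℝ)) x'), 0) := h
      rw [hZ₂sheet, hZ₂sheet] at h'
      have := congrArg Prod.fst (hΛ₂i (he'.injective h'))
      simp only at this; rw [this])
    (fun pw hpw => by
      obtain ⟨x, hx, rfl⟩ := hpw
      exact exists_nhds_injOn_retraction_comp hι hιimm hT hr hG₂d (hKsT x) (hZ₂inj x hx))
  -- continuity of `Φ` at the boundary points
  have hΦc : ∀ u ∈ Kb, ContinuousAt Φ u := fun u hu =>
    hΦsm.continuousOn.continuousAt (hUsmo.mem_nhds (hKbUsm hu))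
  -- near each boundary point, points of `M` lie on the parabola
  have hoff₁ : ∀ u₀ ∈ Kb, ∃ t : Set (ℝ × ℝ), IsOpen t ∧ u₀ ∈ t ∧
      ∀ u ∈ t, Φ u ∈ range e → u.2 = u.1 ^ 2 - 1 := by
    intro u₀ hu₀
    -- either `u₀` is a parabola point, or a point of the open axis arc
    have key : (∃ x₀ ∈ Icc (-1 : ℝ) 1, u₀ = (x₀, x₀ ^ 2 - 1)) ∨
        (∃ x₀ : ℝ, -1 < x₀ ∧ x₀ < 1 ∧ u₀ = (x₀, 0)) := by
      rcases hu₀ with ⟨x, hx, rfl⟩ | ⟨x, hx, rfl⟩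
      · exact Or.inl ⟨x, hx, rfl⟩
      · rcases eq_or_lt_of_le hx.1 with h | h
        · refine Or.inl ⟨-1, hm1, ?_⟩; rw [← h]; norm_num
        rcases eq_or_lt_of_le hx.2 with h' | h'
        · refine Or.inl ⟨1, hp1, ?_⟩; rw [h']; norm_num
        · exact Or.inr ⟨x, h, h', rfl⟩
    rcases key with ⟨x₀, hx₀, rfl⟩ | ⟨x₀, h₁, h₂, rfl⟩
    · have hev := eventually_mem_range_imp_eq_graph (F := F₁) he.isInducing hΛ₁
        (γ := fun x : ℝ => x ^ 2 - 1) (by fun_prop) h𝒱₁o hinj𝒱₁ hZ₁sheet hZ₁core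
        (hK𝒱₁ ⟨x₀, hx₀, rfl⟩) (hΦc _ (Or.inl ⟨x₀, hx₀, rfl⟩))
      obtain ⟨t, ht, hto, hx₀t⟩ := _root_.eventually_nhds_iff.1 hev
      exact ⟨t, hto, hx₀t, ht⟩
    · -- the open axis arc misses the closed set `M`
      have hnot : Φ (x₀, 0) ∉ range e := by
        rw [hΦseg]
        intro hmem
        rcases hdp₂ (x₀, 0) hmem with h | h
        · have := congrArg Prod.fst h; simp only at this; linarith
        · have := congrArg Prod.fst h; simp only at this; linarith
      have hev : ∀ᶠ u in 𝓝 ((x₀, 0) : ℝ × ℝ), Φ u ∉ range e :=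
        (hΦc _ (Or.inr ⟨x₀, ⟨h₁.le, h₂.le⟩, rfl⟩)).preimage_mem_nhds
          (heC.isOpen_compl.mem_nhds hnot)
      obtain ⟨t, ht, hto, hx₀t⟩ := _root_.eventually_nhds_iff.1 hev
      exact ⟨t, hto, hx₀t, fun u hu hue => absurd hue (ht u hu)⟩
  -- near each boundary point, points of `M'` lie on the axis
  have hoff₂ : ∀ u₀ ∈ Kb, ∃ t : Set (ℝ × ℝ), IsOpen t ∧ u₀ ∈ t ∧
      ∀ u ∈ t, Φ u ∈ range e' → u.2 = 0 := by
    intro u₀ hu₀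
    have key : (∃ x₀ ∈ Icc (-1 : ℝ) 1, u₀ = (x₀, 0)) ∨
        (∃ x₀ : ℝ, -1 < x₀ ∧ x₀ < 1 ∧ u₀ = (x₀, x₀ ^ 2 - 1)) := by
      rcases hu₀ with ⟨x, hx, rfl⟩ | ⟨x, hx, rfl⟩
      · rcases eq_or_lt_of_le hx.1 with h | h
        · refine Or.inl ⟨-1, hm1, ?_⟩; rw [← h]; norm_num
        rcases eq_or_lt_of_le hx.2 with h' | h'
        · refine Or.inl ⟨1, hp1, ?_⟩; rw [h']; norm_num
        · exact Or.inr ⟨x, h, h', rfl⟩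
      · exact Or.inl ⟨x, hx, rfl⟩
    rcases key with ⟨x₀, hx₀, rfl⟩ | ⟨x₀, h₁, h₂, rfl⟩
    · have hev := eventually_mem_range_imp_eq_graph (F := F₂) he'.isInducing hΛ₂
        (γ := fun _ : ℝ => (0 : ℝ)) (by fun_prop) h𝒱₂o hinj𝒱₂ hZ₂sheet hZ₂core
        (hK𝒱₂ ⟨x₀, hx₀, rfl⟩) (hΦc _ (Or.inr ⟨x₀, hx₀, rfl⟩))
      obtain ⟨t, ht, hto, hx₀t⟩ := _root_.eventually_nhds_iff.1 hev
      exact ⟨t, hto, hx₀t, ht⟩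
    · have hnot : Φ (x₀, x₀ ^ 2 - 1) ∉ range e' := by
        rw [hΦpar]
        intro hmem
        rcases hdp₁ (x₀, 0) hmem with h | h
        · have := congrArg Prod.fst h; simp only at this; linarith
        · have := congrArg Prod.fst h; simp only at this; linarith
      have hev : ∀ᶠ u in 𝓝 ((x₀, x₀ ^ 2 - 1) : ℝ × ℝ), Φ u ∉ range e' :=
        (hΦc _ (Or.inl ⟨x₀, ⟨h₁.le, h₂.le⟩, rfl⟩)).preimage_mem_nhds
          (he'C.isOpen_compl.mem_nhds hnot)
      obtain ⟨t, ht, hto, hx₀t⟩ := _root_.eventually_nhds_iff.1 hev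
      exact ⟨t, hto, hx₀t, fun u hu hue => absurd hue (ht u hu)⟩
  choose! t₁ ht₁o ht₁m ht₁ using hoff₁
  choose! t₂ ht₂o ht₂m ht₂ using hoff₂
  set Ue : Set (ℝ × ℝ) := ⋃ u₀ ∈ Kb, t₁ u₀ with hUe
  set Ue' : Set (ℝ × ℝ) := ⋃ u₀ ∈ Kb, t₂ u₀ with hUe'
  have hUeo : IsOpen Ue := isOpen_biUnion fun u₀ hu₀ => ht₁o u₀ hu₀
  have hUe'o : IsOpen Ue' := isOpen_biUnion fun u₀ hu₀ => ht₂o u₀ hu₀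
  have hKbUe : Kb ⊆ Ue := fun u hu => mem_biUnion hu (ht₁m u hu)
  have hKbUe' : Kb ⊆ Ue' := fun u hu => mem_biUnion hu (ht₂m u hu)
  ------------------------------------------------------------------------------------------
  -- Step 8: the frame condition along the two arcs
  ------------------------------------------------------------------------------------------
  have hrd : ∀ v : V, MDifferentiableAt 𝓘(ℝ, EuclideanSpace ℝ (Fin N)) (𝓡 n) rV (ι v) := fun v =>
    (hr.contMDiffAt (hT.mem_nhds (hιT v))).mdifferentiableAt (by simp)
  have hιd : ∀ v : V, MDifferentiableAt (𝓡 n) 𝓘(ℝ, EuclideanSpace ℝ (Fin N)) ι v := fun v =>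
    (hι v).mdifferentiableAt (by simp)
  have hframe₁ : ∀ x ∈ Icc (-1 : ℝ) 1, Injective fun w : (ℝ × ℝ) × F₁ =>
      fderiv ℝ (ι ∘ Φ) (x, x ^ 2 - 1) w.1 + fderiv ℝ μ (x, 0) (0, w.2) := by
    intro x hx
    set u : ℝ × ℝ := (x, x ^ 2 - 1) with hu
    set v : V := e (Λ₁ (x, 0)) with hv
    set L : EuclideanSpace ℝ (Fin N) →L[ℝ] EuclideanSpace ℝ (Fin n) :=
      mfderiv 𝓘(ℝ, EuclideanSpace ℝ (Fin N)) (𝓡 n) rV (ι v) with hL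
    set Dι : EuclideanSpace ℝ (Fin n) →L[ℝ] EuclideanSpace ℝ (Fin N) :=
      mfderiv (𝓡 n) 𝓘(ℝ, EuclideanSpace ℝ (Fin N)) ι v with hDι
    have hLι : ∀ a, L (Dι a) = a := fun a => by
      have := ContinuousLinearMap.ext_iff.1 (mfderiv_retraction_comp_mfderiv' hι hT hr hιT hrι v) a
      exact this
    have hLN : ∀ w ∈ (LinearMap.range (Dι : EuclideanSpace ℝ (Fin n) →ₗ[ℝ]
        EuclideanSpace ℝ (Fin N)))ᗮ, L w = 0 := fun w hw => hrN v w hw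
    have hφu : φ u = ι v := hpar x
    have hΦu : Φ u = v := hΦpar x
    have hr' : HasMFDerivAt 𝓘(ℝ, EuclideanSpace ℝ (Fin N)) (𝓡 n) rV (φ u) L := by
      rw [hφu]; exact (hrd v).hasMFDerivAt
    have hι' : HasMFDerivAt (𝓡 n) 𝓘(ℝ, EuclideanSpace ℝ (Fin N)) ι (Φ u) Dι := by
      rw [hΦu]; exact (hιd v).hasMFDerivAt
    have hφ' : HasMFDerivAt 𝓘(ℝ, ℝ × ℝ) 𝓘(ℝ, EuclideanSpace ℝ (Fin N)) φ u (fderiv ℝ φ u) :=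
      (hφdiff u).hasFDerivAt.hasMFDerivAt
    have hΦ' : HasMFDerivAt 𝓘(ℝ, ℝ × ℝ) (𝓡 n) Φ u (L.comp (fderiv ℝ φ u)) := hr'.comp u hφ'
    have hI1 : ∀ w₁, fderiv ℝ (ι ∘ Φ) u w₁ = Dι (L (fderiv ℝ φ u w₁)) := fun w₁ => by
      have h := (hι'.comp u hΦ').mfderiv
      rw [mfderiv_eq_fderiv] at h
      rw [h]; rfl
    have hI2 : ∀ f : F₁, fderiv ℝ μ (x, 0) (0, f) = Dι (L (fderiv ℝ μ (x, 0) (0, f))) := fun f =>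
      (apply_leftInverse_of_mem_range hLι (hμT (x, 0) ⟨_, rfl⟩)).symm
    set B : (ℝ × ℝ) × F₁ →L[ℝ] EuclideanSpace ℝ (Fin N) :=
      (fderiv ℝ φ u).comp (ContinuousLinearMap.fst ℝ (ℝ × ℝ) F₁) +
        ((fderiv ℝ μ (x, 0)).comp (ContinuousLinearMap.inr ℝ ℝ F₁)).comp
          (ContinuousLinearMap.snd ℝ (ℝ × ℝ) F₁) with hB
    have hLB : Injective (L.comp B) :=
      injective_comp_of_apply_mem_orthogonal_imp hLι hLN fun w hw => hker₁ x hx w hw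
    have hmap : ∀ w : (ℝ × ℝ) × F₁,
        fderiv ℝ (ι ∘ Φ) u w.1 + fderiv ℝ μ (x, 0) (0, w.2) = Dι (L (B w)) := fun w => by
      rw [hI1, hI2, ← map_add, ← map_add]; rfl
    intro w₁ w₂ h
    have h' : Dι (L (B w₁)) = Dι (L (B w₂)) := by rw [← hmap, ← hmap]; exact h
    exact hLB (hιimm v h')
  have hframe₂ : ∀ x ∈ Icc (-1 : ℝ) 1, Injective fun w : (ℝ × ℝ) × F₂ =>
      fderiv ℝ (ι ∘ Φ) (x, 0) w.1 + fderiv ℝ μ' (x, 0) (0, w.2) := by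
    intro x hx
    set u : ℝ × ℝ := (x, 0) with hu
    set v : V := e' (Λ₂ (x, 0)) with hv
    set L : EuclideanSpace ℝ (Fin N) →L[ℝ] EuclideanSpace ℝ (Fin n) :=
      mfderiv 𝓘(ℝ, EuclideanSpace ℝ (Fin N)) (𝓡 n) rV (ι v) with hL
    set Dι : EuclideanSpace ℝ (Fin n) →L[ℝ] EuclideanSpace ℝ (Fin N) :=
      mfderiv (𝓡 n) 𝓘(ℝ, EuclideanSpace ℝ (Fin N)) ι v with hDι
    have hLι : ∀ a, L (Dι a) = a := fun a => by
      have := ContinuousLinearMap.ext_iff.1 (mfderiv_retraction_comp_mfderiv' hι hT hr hιT hrι v) a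
      exact this
    have hLN : ∀ w ∈ (LinearMap.range (Dι : EuclideanSpace ℝ (Fin n) →ₗ[ℝ]
        EuclideanSpace ℝ (Fin N)))ᗮ, L w = 0 := fun w hw => hrN v w hw
    have hφu : φ u = ι v := hseg x
    have hΦu : Φ u = v := hΦseg x
    have hr' : HasMFDerivAt 𝓘(ℝ, EuclideanSpace ℝ (Fin N)) (𝓡 n) rV (φ u) L := by
      rw [hφu]; exact (hrd v).hasMFDerivAt
    have hι' : HasMFDerivAt (𝓡 n) 𝓘(ℝ, EuclideanSpace ℝ (Fin N)) ι (Φ u) Dι := by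
      rw [hΦu]; exact (hιd v).hasMFDerivAt
    have hφ' : HasMFDerivAt 𝓘(ℝ, ℝ × ℝ) 𝓘(ℝ, EuclideanSpace ℝ (Fin N)) φ u (fderiv ℝ φ u) :=
      (hφdiff u).hasFDerivAt.hasMFDerivAt
    have hΦ' : HasMFDerivAt 𝓘(ℝ, ℝ × ℝ) (𝓡 n) Φ u (L.comp (fderiv ℝ φ u)) := hr'.comp u hφ'
    have hI1 : ∀ w₁, fderiv ℝ (ι ∘ Φ) u w₁ = Dι (L (fderiv ℝ φ u w₁)) := fun w₁ => by
      have h := (hι'.comp u hΦ').mfderiv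
      rw [mfderiv_eq_fderiv] at h
      rw [h]; rfl
    have hI2 : ∀ f : F₂, fderiv ℝ μ' (x, 0) (0, f) = Dι (L (fderiv ℝ μ' (x, 0) (0, f))) := fun f =>
      (apply_leftInverse_of_mem_range hLι (hμ'T (x, 0) ⟨_, rfl⟩)).symm
    set B : (ℝ × ℝ) × F₂ →L[ℝ] EuclideanSpace ℝ (Fin N) :=
      (fderiv ℝ φ u).comp (ContinuousLinearMap.fst ℝ (ℝ × ℝ) F₂) +
        ((fderiv ℝ μ' (x, 0)).comp (ContinuousLinearMap.inr ℝ ℝ F₂)).comp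
          (ContinuousLinearMap.snd ℝ (ℝ × ℝ) F₂) with hB
    have hLB : Injective (L.comp B) :=
      injective_comp_of_apply_mem_orthogonal_imp hLι hLN fun w hw => hker₂ x hx w hw
    have hmap : ∀ w : (ℝ × ℝ) × F₂,
        fderiv ℝ (ι ∘ Φ) u w.1 + fderiv ℝ μ' (x, 0) (0, w.2) = Dι (L (B w)) := fun w => by
      rw [hI1, hI2, ← map_add, ← map_add]; rfl
    intro w₁ w₂ h
    have h' : Dι (L (B w₁)) = Dι (L (B w₂)) := by rw [← hmap, ← hmap]; exact h
    exact hLB (hιimm v h')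
  ------------------------------------------------------------------------------------------
  -- Assembly
  ------------------------------------------------------------------------------------------
  have hKb_of : ∀ u : ℝ × ℝ, u.1 ∈ Icc (-1 : ℝ) 1 ∧ (u.2 = u.1 ^ 2 - 1 ∨ u.2 = 0) → u ∈ Kb := by
    rintro ⟨a, b⟩ ⟨ha, hb | hb⟩
    · exact Or.inl ⟨a, ha, by simp only at hb; rw [hb]⟩
    · exact Or.inr ⟨a, ha, by simp only at hb; rw [hb]⟩
  refine ⟨φ, ((Uimm ∩ Uinj) ∩ Ue) ∩ Ue', hφd,
    ((hUimmo.inter hUinjo).inter hUeo).inter hUe'o,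
    fun u hu => ⟨⟨⟨hKbUimm (hKb_of u hu), hKbUinj (hKb_of u hu)⟩, hKbUe (hKb_of u hu)⟩,
      hKbUe' (hKb_of u hu)⟩,
    hpar, hseg, fun u hu => hu.1.1.1.1, hΦsm.mono fun u hu => hu.1.1.1.1,
    hinjU.mono fun u hu => hu.1.1.2, fun u hu => himm u hu.1.1.1, fun u hu => ?_,
    fun u hu => ?_, hframe₁, hframe₂⟩
  · obtain ⟨u₀, hu₀, hu'⟩ := mem_iUnion₂.1 hu.1.2
    exact ht₁ u₀ hu₀ u hu'
  · obtain ⟨u₀, hu₀, hu'⟩ := mem_iUnion₂.1 hu.2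
    exact ht₂ u₀ hu₀ u hu'

end Core

end Literature.Topology.FourManifolds
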